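import Literature.Analysis.FluidPDE.PassiveVectorTensorWeakContinuity
import HarnessLib
import HarnessLib

/-!
# K1L_D (stmt-AnomalousDissipation-27980), brick Z1′ support: public copies of the scalar / orthonormal-basis / reflection TOOLS of `PassiveVectorTensorDuality`
# (helper; `--supports … --as helper`; lead-k1l-onelevel-p1 g3; no definitions, no named facts)

`PassiveVectorTensorDuality.lean` proves the constancy of the duality pairing `s ↦ ∫⟪u(s), ψ(t₀ − s)⟫` of a weak tensor passive-vector solution with
an adjoint solution along a Fourier–Galerkin road whose elementary tools (product rule for complex primitives, the reflection `s ↦ t₀ − s` on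
`(0,t₀)`, orthonormal-basis bookkeeping in `k^⊥`, Cauchy–Schwarz for square roots, the reflected carrier in `convect`) are PRIVATE there.  The
TWO-PROBLEM generalisation of that theorem (different tensors and carriers for `u` and `ψ`, cross terms kept — brick Z1′ of the K1L_D line
«onelevel-design», cell `ad-ideate`, `Cruxes/LagrangianRenormalisationStep/Lines/onelevel_Z_bricks.lean`) re-runs the same road from another file;
THIS FILE makes the tools importable, VERBATIM copies of the private lemmas with the `private` modifier (and the `` suffix) dropped.
[cite: Temam1984, Ch. III §1 Lemma 1.2] [cite: RobinsonRodrigoSadowski2016, §4.1]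
-/

set_option linter.dupNamespace false

noncomputable section

open MeasureTheory Set Filter Function TopologicalSpace Complex UnitAddTorus
open scoped ENNReal NNReal InnerProductSpace Topology ComplexConjugate

namespace Summit.AnomalousDissipation.AnomalousDissipation.Theorems.SolenoidalFractalHomogenisation.LagrangianStep.DualityTools

open Literature.Analysis Literature.Analysis.FluidPDE Literature.Analysis.FluidPDE.Torus

variable {d : Type*} [Fintype d] [DecidableEq d]

section Scalar

omit [Fintype d] [DecidableEq d] in
/-- **Fubini on a triangle, complex-valued.** For `f, g : ℝ → ℂ` integrable on `(a, b]`,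
`∫_{(a,b]} f(s) (∫_{(a,s]} g) ds + ∫_{(a,b]} g(r) (∫_{(a,r]} f) dr = (∫_{(a,b]} f) (∫_{(a,b]} g)`
(the real statement is `FunctionSpaces.setIntegral_mul_setIntegral_add_symm`). [folklore] -/
theorem setIntegral_mul_setIntegral_add_symm_complex {a b : ℝ} {f g : ℝ → ℂ}
    (hf : IntegrableOn f (Ioc a b)) (hg : IntegrableOn g (Ioc a b)) :
    (∫ s in Ioc a b, f s * ∫ r in Ioc a s, g r) + (∫ r in Ioc a b, g r * ∫ s in Ioc a r, f s) =
      (∫ s in Ioc a b, f s) * ∫ r in Ioc a b, g r := by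
  set μ : Measure ℝ := volume.restrict (Ioc a b) with hμ
  have hprod : Integrable (fun z : ℝ × ℝ => f z.1 * g z.2) (μ.prod μ) := hf.mul_prod hg
  have hS : MeasurableSet {z : ℝ × ℝ | z.2 ≤ z.1} := measurableSet_le measurable_snd measurable_fst
  rw [← integral_prod_mul (μ := μ) (ν := μ) f g,
    ← indicator_self_add_compl {z : ℝ × ℝ | z.2 ≤ z.1} (fun z : ℝ × ℝ => f z.1 * g z.2),
    integral_add' (hprod.indicator hS) (hprod.indicator hS.compl)]
  congr 1
  · rw [integral_prod _ (hprod.indicator hS)]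
    refine integral_congr_ae ?_
    filter_upwards [ae_restrict_mem measurableSet_Ioc] with s hs
    have h1 : (fun r => {z : ℝ × ℝ | z.2 ≤ z.1}.indicator (fun z : ℝ × ℝ => f z.1 * g z.2) (s, r)) =
        fun r => f s * (Iic s).indicator g r := by
      funext r
      by_cases hr : r ≤ s
      · rw [indicator_of_mem (show (s, r) ∈ {z : ℝ × ℝ | z.2 ≤ z.1} from hr),
          indicator_of_mem (show r ∈ Iic s from hr)]
      · rw [indicator_of_notMem (show (s, r) ∉ {z : ℝ × ℝ | z.2 ≤ z.1} from hr),
          indicator_of_notMem (show r ∉ Iic s from hr), mul_zero]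
    have hset : Ioc a b ∩ Iic s = Ioc a s := by
      ext r
      simp only [mem_inter_iff, mem_Ioc, mem_Iic]
      constructor
      · rintro ⟨⟨h1, -⟩, h3⟩
        exact ⟨h1, h3⟩
      · rintro ⟨h1, h2⟩
        exact ⟨⟨h1, h2.trans hs.2⟩, h2⟩
    rw [h1, MeasureTheory.integral_const_mul, hμ, setIntegral_indicator measurableSet_Iic, hset]
  · rw [integral_prod_symm _ (hprod.indicator hS.compl)]
    refine integral_congr_ae ?_
    filter_upwards [ae_restrict_mem measurableSet_Ioc] with r hr
    have h1 : (fun s => {z : ℝ × ℝ | z.2 ≤ z.1}ᶜ.indicator (fun z : ℝ × ℝ => f z.1 * g z.2) (s, r)) =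
        fun s => g r * (Iio r).indicator f s := by
      funext s
      by_cases hs : s < r
      · rw [indicator_of_mem (show (s, r) ∈ {z : ℝ × ℝ | z.2 ≤ z.1}ᶜ from not_le.2 hs),
          indicator_of_mem (show s ∈ Iio r from hs), mul_comm]
      · rw [indicator_of_notMem (show (s, r) ∉ {z : ℝ × ℝ | z.2 ≤ z.1}ᶜ from
            fun h => h (not_lt.1 hs)),
          indicator_of_notMem (show s ∉ Iio r from hs), mul_zero]
    have hset : Ioc a b ∩ Iio r = Ioo a r := by
      ext s
      simp only [mem_inter_iff, mem_Ioc, mem_Iio, mem_Ioo]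
      constructor
      · rintro ⟨⟨h1, -⟩, h3⟩
        exact ⟨h1, h3⟩
      · rintro ⟨h1, h2⟩
        exact ⟨⟨h1, h2.le.trans hr.2⟩, h2⟩
    rw [h1, MeasureTheory.integral_const_mul, hμ, setIntegral_indicator measurableSet_Iio, hset,
      integral_Ioc_eq_integral_Ioo]

omit [Fintype d] [DecidableEq d] in
/-- **Product formula for complex primitives** (integration by parts for absolutely continuous
functions, in integral form): if `F(t) = α + ∫_{(0,t]} φ` and `G(t) = β + ∫_{(0,t]} γ` on `(0, T]`
with `φ, γ ∈ L¹(0,T; ℂ)`, then `s ↦ φ(s)G(s) + F(s)γ(s)` is integrable on `(0,t]` and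
`F(t)G(t) = αβ + ∫_{(0,t]} (φ G + F γ)` for every `t ∈ (0, T]` (the real statement is
`FunctionSpaces.mul_eq_add_setIntegral_of_eq_add_setIntegral`). [folklore] -/
theorem mul_eq_add_setIntegral_of_eq_add_setIntegral_complex {T : ℝ} {F G φ γ : ℝ → ℂ} {α β : ℂ}
    (hφ : IntegrableOn φ (Ioo 0 T)) (hγ : IntegrableOn γ (Ioo 0 T))
    (hF : ∀ t ∈ Ioc 0 T, F t = α + ∫ s in Ioc 0 t, φ s)
    (hG : ∀ t ∈ Ioc 0 T, G t = β + ∫ s in Ioc 0 t, γ s) {t : ℝ} (ht : t ∈ Ioc 0 T) :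
    IntegrableOn (fun s => φ s * G s + F s * γ s) (Ioc 0 t) ∧
      F t * G t = α * β + ∫ s in Ioc 0 t, (φ s * G s + F s * γ s) := by
  have hsub : Ioc 0 t ⊆ Ioc 0 T := Ioc_subset_Ioc_right ht.2
  have hφT : IntegrableOn φ (Ioc 0 T) := (integrableOn_Ioc_iff_integrableOn_Ioo (f := φ)).2 hφ
  have hγT : IntegrableOn γ (Ioc 0 T) := (integrableOn_Ioc_iff_integrableOn_Ioo (f := γ)).2 hγ
  have hφt : IntegrableOn φ (Ioc 0 t) := hφT.mono_set hsub
  have hγt : IntegrableOn γ (Ioc 0 t) := hγT.mono_set hsub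
  set Φ : ℝ → ℂ := fun s => ∫ r in Ioc 0 s, φ r with hΦ
  set Γ : ℝ → ℂ := fun s => ∫ r in Ioc 0 s, γ r with hΓ
  have hΦc : ContinuousOn Φ (Icc 0 t) :=
    intervalIntegral.continuousOn_primitive ((integrableOn_Icc_iff_integrableOn_Ioc (f := φ)).2 hφt)
  have hΓc : ContinuousOn Γ (Icc 0 t) :=
    intervalIntegral.continuousOn_primitive ((integrableOn_Icc_iff_integrableOn_Ioc (f := γ)).2 hγt)
  obtain ⟨CΦ, hCΦ⟩ := isCompact_Icc.exists_bound_of_continuousOn hΦc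
  obtain ⟨CΓ, hCΓ⟩ := isCompact_Icc.exists_bound_of_continuousOn hΓc
  have hΦm : AEStronglyMeasurable Φ (volume.restrict (Ioc 0 t)) :=
    (hΦc.mono Ioc_subset_Icc_self).aestronglyMeasurable measurableSet_Ioc
  have hΓm : AEStronglyMeasurable Γ (volume.restrict (Ioc 0 t)) :=
    (hΓc.mono Ioc_subset_Icc_self).aestronglyMeasurable measurableSet_Ioc
  have hΦb : ∀ᵐ s ∂(volume.restrict (Ioc 0 t)), ‖Φ s‖ ≤ CΦ :=
    (ae_restrict_mem measurableSet_Ioc).mono fun s hs => hCΦ s (Ioc_subset_Icc_self hs)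
  have hΓb : ∀ᵐ s ∂(volume.restrict (Ioc 0 t)), ‖Γ s‖ ≤ CΓ :=
    (ae_restrict_mem measurableSet_Ioc).mono fun s hs => hCΓ s (Ioc_subset_Icc_self hs)
  have i1 : IntegrableOn (fun s => φ s * Γ s) (Ioc 0 t) := by
    have h := hφt.bdd_mul hΓm hΓb
    exact h.congr (ae_of_all _ fun s => mul_comm _ _)
  have i2 : IntegrableOn (fun s => γ s * Φ s) (Ioc 0 t) := by
    have h := hγt.bdd_mul hΦm hΦb
    exact h.congr (ae_of_all _ fun s => mul_comm _ _)
  have hG' : ∀ᵐ s ∂(volume.restrict (Ioc 0 t)), φ s * G s = β * φ s + φ s * Γ s :=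
    (ae_restrict_mem measurableSet_Ioc).mono fun s hs => by rw [hG s (hsub hs)]; ring
  have hF' : ∀ᵐ s ∂(volume.restrict (Ioc 0 t)), F s * γ s = α * γ s + γ s * Φ s :=
    (ae_restrict_mem measurableSet_Ioc).mono fun s hs => by rw [hF s (hsub hs)]; ring
  have j1 : IntegrableOn (fun s => φ s * G s) (Ioc 0 t) :=
    ((hφt.const_mul β).add i1).congr (hG'.mono fun s hs => hs.symm)
  have j2 : IntegrableOn (fun s => F s * γ s) (Ioc 0 t) :=
    ((hγt.const_mul α).add i2).congr (hF'.mono fun s hs => hs.symm)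
  refine ⟨j1.add j2, ?_⟩
  rw [integral_add j1 j2, integral_congr_ae hG', integral_congr_ae hF',
    integral_add (hφt.const_mul β) i1, integral_add (hγt.const_mul α) i2, MeasureTheory.integral_const_mul,
    MeasureTheory.integral_const_mul, hF t ht, hG t ht]
  have key := setIntegral_mul_setIntegral_add_symm_complex hφt hγt
  calc (α + Φ t) * (β + Γ t) = α * β + (β * Φ t + α * Γ t + Φ t * Γ t) := by ring
    _ = α * β + (β * Φ t + (∫ s in Ioc 0 t, φ s * Γ s) + (α * Γ t + ∫ s in Ioc 0 t, γ s * Φ s)) := by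
        rw [hΦ, hΓ]
        dsimp only
        rw [← key]
        ring

omit [Fintype d] [DecidableEq d] in
/-- Time reversal `s ↦ t₀ - s` is measure preserving on Lebesgue measure. [folklore] -/
theorem measurePreserving_sub_left (t₀ : ℝ) :
    MeasurePreserving (fun s : ℝ => t₀ - s) volume volume :=
  Measure.measurePreserving_sub_left volume t₀

omit [Fintype d] [DecidableEq d] in
/-- Time reversal is a measurable embedding. [folklore] -/
theorem measurableEmbedding_sub_left (t₀ : ℝ) :
    MeasurableEmbedding (fun s : ℝ => t₀ - s) :=
  (MeasurableEquiv.subLeft t₀).measurableEmbedding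

omit [Fintype d] [DecidableEq d] in
/-- Time reversal maps `(0,t₀)` onto itself. [folklore] -/
theorem preimage_sub_left_Ioo (t₀ : ℝ) : (fun s : ℝ => t₀ - s) ⁻¹' Ioo 0 t₀ = Ioo 0 t₀ := by
  ext s
  simp only [mem_preimage, mem_Ioo]
  constructor <;> rintro ⟨h1, h2⟩ <;> constructor <;> linarith

omit [Fintype d] [DecidableEq d] in
/-- Time reversal of integrability on `(0,t₀)`. [folklore] -/
theorem integrableOn_comp_sub_left {E : Type*} [NormedAddCommGroup E] {t₀ : ℝ} {f : ℝ → E}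
    (hf : IntegrableOn f (Ioo 0 t₀)) : IntegrableOn (fun s => f (t₀ - s)) (Ioo 0 t₀) := by
  have h := ((measurePreserving_sub_left t₀).integrableOn_comp_preimage
    (measurableEmbedding_sub_left t₀) (f := f) (s := Ioo 0 t₀)).2 hf
  rw [preimage_sub_left_Ioo] at h
  exact h

omit [Fintype d] [DecidableEq d] in
/-- Time reversal of set integrals over `(0,t₀)`: `∫_{(0,t₀)} f(t₀ - s) ds = ∫_{(0,t₀)} f`. [folklore] -/
theorem setIntegral_Ioo_comp_sub_left {E : Type*} [NormedAddCommGroup E] [NormedSpace ℝ E]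
    {t₀ : ℝ} (f : ℝ → E) : ∫ s in Ioo 0 t₀, f (t₀ - s) = ∫ r in Ioo 0 t₀, f r := by
  have h := (measurePreserving_sub_left t₀).setIntegral_preimage_emb (measurableEmbedding_sub_left t₀) f (Ioo 0 t₀)
  rwa [preimage_sub_left_Ioo] at h

omit [Fintype d] [DecidableEq d] in
/-- **The reversed primitive.** For `γ ∈ L¹(0,t₀)` and `s ∈ [0,t₀]`:
`∫_{(0,t₀-s]} γ = ∫_{(0,t₀]} γ + ∫_{(0,s]} (−γ(t₀ − σ)) dσ`. [folklore] -/
theorem setIntegral_Ioc_sub_eq {E : Type*} [NormedAddCommGroup E] [NormedSpace ℝ E] [CompleteSpace E]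
    {t₀ : ℝ} {γ : ℝ → E} (hγ : IntegrableOn γ (Ioo 0 t₀)) {s : ℝ} (hs : s ∈ Icc 0 t₀) :
    ∫ σ in Ioc 0 (t₀ - s), γ σ = (∫ σ in Ioc 0 t₀, γ σ) + ∫ σ in Ioc 0 s, -γ (t₀ - σ) := by
  have hγI : IntegrableOn γ (Icc 0 t₀) := (integrableOn_Icc_iff_integrableOn_Ioo (f := γ)).2 hγ
  have hi : ∀ {a c : ℝ}, 0 ≤ a → a ≤ c → c ≤ t₀ → IntervalIntegrable γ volume a c := by
    intro a c ha hac hc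
    refine (hγI.mono_set ?_).intervalIntegrable
    rw [uIcc_of_le hac]
    exact Icc_subset_Icc ha hc
  have h1 : 0 ≤ t₀ - s := by linarith [hs.2]
  have h2 : t₀ - s ≤ t₀ := by linarith [hs.1]
  rw [← intervalIntegral.integral_of_le h1, ← intervalIntegral.integral_of_le (hs.1.trans hs.2),
    ← intervalIntegral.integral_of_le hs.1, intervalIntegral.integral_neg,
    intervalIntegral.integral_comp_sub_left (fun σ => γ σ) t₀, sub_zero,
    ← intervalIntegral.integral_add_adjacent_intervals (hi le_rfl h1 h2) (hi h1 h2 le_rfl)]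
  abel

end Scalar

section Onb

omit [DecidableEq d]

/-- Pulling a scalar out of a transport sum. [folklore] -/
theorem modeRHS_sumpull (k : d → ℤ) (μ : ℂ) (f : d → ℂ) :
    ∑ j, (2 * Real.pi * I * (k j)) * (μ * f j) = μ * ∑ j, (2 * Real.pi * I * (k j)) * f j := by
  rw [Finset.mul_sum]; exact Finset.sum_congr rfl fun j _ => by ring

/-- The mode right-hand side `H(z) = −4π² ⟪X, T_𝔸(k) z⟫ + B(z)` is `ℂ`-linear in `z`:
`H(Σᵢ μᵢ eᵢ) = Σᵢ μᵢ H(eᵢ)`. [folklore] -/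
theorem modeRHS_sum_smul {ι : Type*} (s : Finset ι) (𝔸 : Visc4 d) (k : d → ℤ) (A : ℝ)
    (X : EuclideanSpace ℂ d) (F G : d → EuclideanSpace ℂ d) (μ : ι → ℂ) (e : ι → EuclideanSpace ℂ d) :
    (-(4 * Real.pi ^ 2 : ℝ) : ℂ) * ⟪X, symbT 𝔸 k (∑ i ∈ s, μ i • e i)⟫_ℂ +
        ((∑ j, (2 * Real.pi * I * (k j)) * ⟪F j, ∑ i ∈ s, μ i • e i⟫_ℂ) +
          (A : ℂ) * ∑ j, (2 * Real.pi * I * (k j)) * ⟪G j, ∑ i ∈ s, μ i • e i⟫_ℂ) =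
      ∑ i ∈ s, μ i * ((-(4 * Real.pi ^ 2 : ℝ) : ℂ) * ⟪X, symbT 𝔸 k (e i)⟫_ℂ +
        ((∑ j, (2 * Real.pi * I * (k j)) * ⟪F j, e i⟫_ℂ) + (A : ℂ) * ∑ j, (2 * Real.pi * I * (k j)) * ⟪G j, e i⟫_ℂ)) := by
  classical
  induction s using Finset.induction_on with
  | empty => simp
  | insert a s ha ih =>
    rw [Finset.sum_insert ha, Finset.sum_insert ha, ← ih]
    simp only [symbT_add, symbT_smul, inner_add_right, inner_smul_right, mul_add, Finset.sum_add_distrib,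
      modeRHS_sumpull]
    ring

/-- Expansion in a subspace with conjugated coefficients: `Σᵢ conj⟪X, eᵢ⟫ eᵢ = X` for `X ∈ S`.
[folklore] -/
theorem sum_conj_inner_smul_onb {ι : Type*} [Fintype ι] {S : Submodule ℂ (EuclideanSpace ℂ d)}
    (b : OrthonormalBasis ι ℂ S) {X : EuclideanSpace ℂ d} (hX : X ∈ S) :
    ∑ i, conj ⟪X, (b i : EuclideanSpace ℂ d)⟫_ℂ • (b i : EuclideanSpace ℂ d) = X := by
  have h := b.sum_repr' ⟨X, hX⟩
  have h' := congrArg (fun v : S => (v : EuclideanSpace ℂ d)) h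
  simp only [Submodule.coe_sum, Submodule.coe_smul, Submodule.coe_inner] at h'
  simp_rw [inner_conj_symm]
  exact h'

/-- The pairing through an orthonormal basis of a subspace containing the second vector:
`Σᵢ ⟪X, eᵢ⟫ conj⟪Y, eᵢ⟫ = ⟪X, Y⟫` for `Y ∈ S` and every `X`. [folklore] -/
theorem sum_inner_mul_conj_inner_onb {ι : Type*} [Fintype ι] {S : Submodule ℂ (EuclideanSpace ℂ d)}
    (b : OrthonormalBasis ι ℂ S) (X : EuclideanSpace ℂ d) {Y : EuclideanSpace ℂ d} (hY : Y ∈ S) :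
    ∑ i, ⟪X, (b i : EuclideanSpace ℂ d)⟫_ℂ * conj ⟪Y, (b i : EuclideanSpace ℂ d)⟫_ℂ = ⟪X, Y⟫_ℂ := by
  conv_rhs => rw [← sum_conj_inner_smul_onb b hY]
  rw [inner_sum]
  refine Finset.sum_congr rfl fun i _ => ?_
  rw [inner_smul_right, mul_comm]


end Onb

section Duality

omit [Fintype d] [DecidableEq d] in
/-- **Cauchy–Schwarz for square roots**: `∫ √f √g ≤ √(∫ f) √(∫ g)` for nonnegative integrable `f, g`.
[folklore] -/
theorem integral_sqrt_mul_sqrt_le {α : Type*} [MeasurableSpace α] {μ : Measure α} {f g : α → ℝ}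
    (hf : Integrable f μ) (hg : Integrable g μ) (hf0 : 0 ≤ᵐ[μ] f) (hg0 : 0 ≤ᵐ[μ] g) :
    ∫ x, Real.sqrt (f x) * Real.sqrt (g x) ∂μ ≤ Real.sqrt (∫ x, f x ∂μ) * Real.sqrt (∫ x, g x ∂μ) := by
  have hmem : ∀ {φ : α → ℝ}, Integrable φ μ → 0 ≤ᵐ[μ] φ →
      MemLp (fun x => Real.sqrt (φ x)) (ENNReal.ofReal 2) μ := by
    intro φ hφ hφ0
    rw [show ENNReal.ofReal 2 = 2 by simp]
    refine (memLp_two_iff_integrable_sq (Real.continuous_sqrt.comp_aestronglyMeasurable hφ.1)).2 ?_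
    refine hφ.congr ?_
    filter_upwards [hφ0] with x hx
    rw [Real.sq_sqrt hx]
  have h := integral_mul_le_Lp_mul_Lq_of_nonneg Real.HolderConjugate.two_two
    (ae_of_all _ fun x => Real.sqrt_nonneg (f x)) (ae_of_all _ fun x => Real.sqrt_nonneg (g x)) (hmem hf hf0) (hmem hg hg0)
  have e1 : ∫ x, Real.sqrt (f x) ^ (2 : ℝ) ∂μ = ∫ x, f x ∂μ := by
    refine integral_congr_ae ?_
    filter_upwards [hf0] with x hx
    rw [Real.rpow_two, Real.sq_sqrt hx]
  have e2 : ∫ x, Real.sqrt (g x) ^ (2 : ℝ) ∂μ = ∫ x, g x ∂μ := by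
    refine integral_congr_ae ?_
    filter_upwards [hg0] with x hx
    rw [Real.rpow_two, Real.sq_sqrt hx]
  rw [e1, e2] at h
  simpa [Real.sqrt_eq_rpow] using h

omit [Fintype d] [DecidableEq d] in
/-- `∫_{(0,s₂]} f − ∫_{(0,s₁]} f = ∫_{(s₁,s₂]} f` for `0 ≤ s₁ ≤ s₂` and `f` integrable on `(0,s₂]`.
[folklore] -/
theorem setIntegral_Ioc_sub_setIntegral_Ioc {E : Type*} [NormedAddCommGroup E] [NormedSpace ℝ E]
    {f : ℝ → E} {s₁ s₂ : ℝ} (hf : IntegrableOn f (Ioc 0 s₂)) (h1 : 0 ≤ s₁) (h12 : s₁ ≤ s₂) :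
    (∫ σ in Ioc 0 s₂, f σ) - ∫ σ in Ioc 0 s₁, f σ = ∫ σ in Ioc s₁ s₂, f σ := by
  have hab : IntervalIntegrable f volume 0 s₂ := by
    rw [intervalIntegrable_iff, uIoc_of_le (h1.trans h12)]; exact hf
  have hac : IntervalIntegrable f volume 0 s₁ := by
    rw [intervalIntegrable_iff, uIoc_of_le h1]; exact hf.mono_set (Ioc_subset_Ioc_right h12)
  rw [← intervalIntegral.integral_of_le (h1.trans h12), ← intervalIntegral.integral_of_le h1,
    ← intervalIntegral.integral_of_le h12, intervalIntegral.integral_interval_sub_left hab hac]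

omit [DecidableEq d] in
/-- `(−c·∇)Ψ = −(c·∇)Ψ` pointwise. [folklore] -/
theorem convect_neg_carrier (c : UnitAddTorus d → EuclideanSpace ℝ d)
    (Ψ : UnitAddTorus d → EuclideanSpace ℝ d) (x : UnitAddTorus d) :
    FunctionSpaces.Torus.convect (-c) Ψ x = -FunctionSpaces.Torus.convect c Ψ x := by
  simp only [FunctionSpaces.Torus.convect, Pi.neg_apply, map_neg]


end Duality

end Summit.AnomalousDissipation.AnomalousDissipation.Theorems.SolenoidalFractalHomogenisation.LagrangianStep.DualityTools
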